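/-
Copyright: statement-level skeleton of a published paper (lit-balaban cell, Phase-2 proof seat p25, gen 21). No proof
claims beyond what the kernel checks below.
-/
import Literature.MathematicalPhysics.QuantumFieldTheory.BalabanImbrieJaffe1984to88.BIJ88RandomWalk242
import Literature.MathematicalPhysics.QuantumFieldTheory.BalabanImbrieJaffe1984to88.BIJ88WalkSplitReach

/-!
# `BalabanImbrieJaffe1984to88.BIJ88WalkSplitSupport245` — T. Bałaban, J. Imbrie, A. Jaffe, *Effective action and
cluster properties of the abelian Higgs model*, Commun. Math. Phys. **114** (1988) 257–315 [BalabanImbrieJaffe1988],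
Sect. 2 p. 264 [PDF 8], verbatim: *"Then we define C^{(k)}_Λ(u) = C^{(k)}_{Λ,loc}(u) + Σ_X C^{(k)}_{Λ,X}(u), (2.45)
and the convergence and locality properties of the random walk expansion imply the following facts about these
operators. The local part C^{(k)}_{Λ,loc}(u; x₁, x₂) depends only on u in an O(r(e_k)) neighborhood of x₁, x₂; it
vanishes for |x₁ − x₂| > ½r(e_k) … The operator C^{(k)}_{Λ,X}(u) depends only on u in X. It vanishes unless both
arguments are in X"* — **THE TWO SUPPORT PROPERTIES OF PRINT'S SPLIT (2.45), IN THE FORM THE §5.14 WEIGHTED-LOCALITY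
CHAIN CONSUMES** (p25 gen 21; file W4d, a MEMBER of row C2.Claim@312, owner r16, referee ref-5; head of record
`BIJ88WalkIneq312RemainderBdry.ineq312_remainder_bdry` UNCHANGED; p13's `BIJ88RandomWalk242` UNCHANGED).

p13's `BIJ88RandomWalk242` PROVES, for the (2.45) objects `cLoc` (the local part `Σ′_ω C_ω`) and `cX X` (the part of
the region `X`, `Σ^X_ω C_ω`), *"vanishes for |x₁ − x₂| > ½r(e_k)"* (`cLoc_eq_zero_of_far`) and *"vanishes unless both
arguments are in X"* (`cX_support`).  Gen 21's `BIJ88WalkSplitReach.split_reach` / `split_weighted_locality` take a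
split indexed by `Option R` with exactly two such properties: `hnone : C_loc(x,y) ≠ 0 ⇒ near (cube y) (cube x)` and
`hsome : C_X(x,y) ≠ 0 ⇒ cube x ∈ X ∧ cube y ∈ X`.  Here they are DERIVED for the family
`p ↦ (none ↦ cLoc, some X ↦ cX X)` from p13's theorems, given a site-to-cube map compatible with the blocks
(`inBlock x j ⇒ cube x ∈ closure{cube j}`) and a cube relation `near` containing the pairs at site distance `≤ 2ρ = ½r(e_k)`.

statement-level skeleton of published theorems with citation tags; proofs where landed; nothing here is a claim
about the Yang–Mills mass gap

PDF held: `paper:balaban1988-cmp114-bij-abelian-higgs-effective-action` (journal page = PDF page + 256); p. 264 = PDF 8.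

CITATION HEADER (lean-in-tree rule).  lit-balaban cell (HOME `run/shared/lean/pub/lit-balaban/`), Phase 2, seat p25
gen 21; row **C2.Claim@312** of `HOME/lit-balaban-r16/ROWS-C2-part2.md` (owner r16, referee ref-5; MEMBER), using
rows C2.Eq2.43–2.46 (p13, `BIJ88RandomWalk242`).  USED BY NAME, nothing restated: `BIJ88RandomWalk242.{Walk, cLoc,
cX, memX, closure, cLoc_eq_zero_of_far, cX_support}` (p13 gen 2); the consumer is `BIJ88WalkSplitReach.split_reach`
(p25 gen 21; v2 imports it and composes: `split_weighted_locality`).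

## What is proved (0 `sorry`, standard axioms, no new `Prop` facts; theorems only, no definitions)

* `cLoc_ne_zero_near`, `cX_ne_zero_mem`, **`split245_support`** (the pair `hnone`, `hsome` for the (2.45) family);
* **`split245_weighted_locality`** (v2, composed with `BIJ88WalkSplitReach.split_weighted_locality`): for print's
  split, one-cube directions and vertex legs (`≤ L` per cube), weights `ρ ≥ 0` whose region parts have per-cube sums
  `a`, `b` and `near`-degree `≤ D`: `Σ_{p : C_p u ≠ 0} ρ_p ≤ ρ_loc + a`, `Σ_p ρ_p·#{coupled legs} ≤ L(ρ_loc·D + b)` —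
  the locality inputs of `BIJ88WalkProductCutoffWeighted312.ineq312_remainder_bdry_prodCutoff_of_reach` /
  `BIJ88WalkIneq312WeightedLocality.ineq312_remainder_bdry_W`, uniformly in the volume.
HONEST SCOPE: (a) the walk terms `C_ω` are p13's abstract kernels with END-POINT LOCALITY (`hsupp`); (b) the
site-to-cube map `cube`, its compatibility with the blocks (`hblk`) and the relation `near ⊇ {site distance ≤ 2ρ}`
(`hnear`) are HYPOTHESES (geometry of the lattice, not modelled here); (c) no bound ((2.46)–(2.47)) is used; (d)
consumers carrying a `DecidableEq κ` instance bridge the classical `Finset.filter` instances of the W-chain statements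
with `convert` (Decidable instances are subsingletons), as in the proof of `split245_weighted_locality`.  NOT summit
progress; NOT continuum; NOT Clay.  Imports `BIJ88RandomWalk242`, `BIJ88WalkSplitReach`; modifies nothing.
-/

noncomputable section

namespace Literature.MathematicalPhysics.QuantumFieldTheory.BalabanImbrieJaffe1984to88.BIJ88WalkSplitSupport245

open Classical Finset Matrix
open scoped BigOperators
open BIJ88RandomWalk242 BIJ88WalkSplitReach

variable {ι α κ : Type*} [DecidableEq ι] [Fintype κ] [DecidableEq κ]

omit [Fintype κ] [DecidableEq κ] in
/-- **THE LOCAL PART REACHES ONLY NEAR CUBES**: if `near` contains every pair of cubes of sites at distance `≤ 2ρ`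
(`2ρ = ½r(e_k)`), then `C_loc(x₁,x₂) ≠ 0 ⇒ near (cube x₂) (cube x₁)` — from p13's `cLoc_eq_zero_of_far`
(*"it vanishes for |x₁ − x₂| > ½r(e_k)"*). [cite: BalabanImbrieJaffe1988, (2.43) p.264] -/
theorem cLoc_ne_zero_near (ldist : ι → α → ℝ) (ρ : ℝ) (Cw : Walk ι → α → α → ℝ) (sdist : α → α → ℝ)
    (htri : ∀ j x₁ x₂, sdist x₁ x₂ ≤ ldist j x₁ + ldist j x₂) (cube : α → κ) (near : κ → κ → Prop)
    (hnear : ∀ x₁ x₂, sdist x₁ x₂ ≤ 2 * ρ → near (cube x₂) (cube x₁)) {x₁ x₂ : α}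
    (h : cLoc ldist ρ Cw x₁ x₂ ≠ 0) : near (cube x₂) (cube x₁) := by
  by_contra hn
  exact h (cLoc_eq_zero_of_far ldist ρ Cw sdist htri (lt_of_not_ge fun hle => hn (hnear x₁ x₂ hle)))

/-- **THE PART OF `X` REACHES ONLY `X`**: if every site of a block lies in a cube of the block's cube closure
(`hblk`), then `C_X(x₁,x₂) ≠ 0 ⇒ cube x₁ ∈ X ∧ cube x₂ ∈ X` — from p13's `cX_support` (*"vanishes unless both
arguments are in X"*, END-POINT LOCALITY `hsupp` of the walk terms). [cite: BalabanImbrieJaffe1988, (2.44), (2.46) p.264] -/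
theorem cX_ne_zero_mem (ldist : ι → α → ℝ) (ρ : ℝ) (cubeOf : ι → κ) (cadj : κ → κ → Prop)
    {Cw : Walk ι → α → α → ℝ} (inBlock : α → ι → Prop)
    (hsupp : ∀ ω x₁ x₂, Cw ω x₁ x₂ ≠ 0 → inBlock x₁ ω.start ∧ inBlock x₂ ω.last)
    (cube : α → κ) (hblk : ∀ x j, inBlock x j → cube x ∈ closure cadj {cubeOf j}) {X : Finset κ} {x₁ x₂ : α}
    (h : cX ldist ρ cubeOf cadj Cw X x₁ x₂ ≠ 0) : cube x₁ ∈ X ∧ cube x₂ ∈ X := by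
  have hmem : memX inBlock cubeOf cadj x₁ X ∧ memX inBlock cubeOf cadj x₂ X := by
    by_contra hno
    exact h (cX_support ldist ρ cubeOf cadj inBlock hsupp X x₁ x₂ hno)
  obtain ⟨⟨j₁, hj₁, hX₁⟩, ⟨j₂, hj₂, hX₂⟩⟩ := hmem
  exact ⟨hX₁ (hblk x₁ j₁ hj₁), hX₂ (hblk x₂ j₂ hj₂)⟩

/-- **THE SUPPORT PROPERTIES OF PRINT'S SPLIT (2.45)** for the family `none ↦ C_loc`, `some X ↦ C_X` (the shape
consumed by `BIJ88WalkSplitReach.split_reach` as `hnone`, `hsome`): the local part is nonzero only between sites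
whose cubes are `near`; the part of `X` only between sites whose cubes lie in `X`.
[cite: BalabanImbrieJaffe1988, (2.43)-(2.46) p.264] -/
theorem split245_support (ldist : ι → α → ℝ) (ρ : ℝ) (cubeOf : ι → κ) (cadj : κ → κ → Prop)
    {Cw : Walk ι → α → α → ℝ} (inBlock : α → ι → Prop)
    (hsupp : ∀ ω x₁ x₂, Cw ω x₁ x₂ ≠ 0 → inBlock x₁ ω.start ∧ inBlock x₂ ω.last)
    (sdist : α → α → ℝ) (htri : ∀ j x₁ x₂, sdist x₁ x₂ ≤ ldist j x₁ + ldist j x₂)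
    (cube : α → κ) (hblk : ∀ x j, inBlock x j → cube x ∈ closure cadj {cubeOf j}) (near : κ → κ → Prop)
    (hnear : ∀ x₁ x₂, sdist x₁ x₂ ≤ 2 * ρ → near (cube x₂) (cube x₁)) :
    (∀ x y, (fun p : Option (Finset κ) => Option.elim p (cLoc ldist ρ Cw) fun X => cX ldist ρ cubeOf cadj Cw X)
        none x y ≠ 0 → near (cube y) (cube x)) ∧
    (∀ X x y, (fun p : Option (Finset κ) => Option.elim p (cLoc ldist ρ Cw) fun X => cX ldist ρ cubeOf cadj Cw X)
        (some X) x y ≠ 0 → cube x ∈ X ∧ cube y ∈ X) :=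
  ⟨fun _ _ h => cLoc_ne_zero_near ldist ρ Cw sdist htri cube near hnear h,
    fun _ _ _ h => cX_ne_zero_mem ldist ρ cubeOf cadj inBlock hsupp cube hblk h⟩

/-- **PRINT'S SPLIT (2.45) HAS VOLUME-UNIFORM WEIGHTED LOCALITY**: for the family `none ↦ C_loc`, `some X ↦ C_X` of
`BIJ88RandomWalk242` (END-POINT LOCALITY `hsupp` of the walk terms; site-to-cube map `cube` compatible with the
blocks; `near ⊇ {site distance ≤ 2ρ}` of degree `≤ D`), directions living in one cube, vertex legs in one cube with
at most `L` per cube, and weights `ρ ≥ 0` whose region parts are summable through every cube (`a` plain, `b` with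
`|X|`; `BIJ88WalkRegionWeightsSummable` for `ρ_X ≤ λ^{|X|}`): for every `u ∈ Dir`,
`Σ_{p : C_p u ≠ 0} ρ_p ≤ ρ_loc + a` and `Σ_p ρ_p·#{(m,j) : ⟨C_p u,(legs m)_j⟩ ≠ 0} ≤ L·(ρ_loc·D + b)` (all
carrier types in `Type`, as in the §5.14 chain).
[cite: BalabanImbrieJaffe1988, (2.43)-(2.46) p.264–265; §5.14 p.310] -/
theorem split245_weighted_locality {ι α κ V : Type} [DecidableEq ι] [Fintype κ] [DecidableEq κ] [Fintype α]
    [Fintype V] (ldist : ι → α → ℝ) (ρr : ℝ) (cubeOf : ι → κ) (cadj : κ → κ → Prop)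
    {Cw : Walk ι → α → α → ℝ} (inBlock : α → ι → Prop)
    (hsupp : ∀ ω x₁ x₂, Cw ω x₁ x₂ ≠ 0 → inBlock x₁ ω.start ∧ inBlock x₂ ω.last)
    (sdist : α → α → ℝ) (htri : ∀ j x₁ x₂, sdist x₁ x₂ ≤ ldist j x₁ + ldist j x₂)
    (cube : α → κ) (hblk : ∀ x j, inBlock x j → cube x ∈ closure cadj {cubeOf j}) (near : κ → κ → Prop)
    (hnear : ∀ x₁ x₂, sdist x₁ x₂ ≤ 2 * ρr → near (cube x₂) (cube x₁))
    {legs : V → List (α → ℝ)} {legCube : V → ℕ → κ} {Dir : Set (α → ℝ)}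
    (hDir : ∀ u ∈ Dir, ∃ k, ∀ y, u y ≠ 0 → cube y = k)
    (hleg : ∀ m j x, ((legs m).getD j 0) x ≠ 0 → cube x = legCube m j) {L : ℕ}
    (hL : ∀ k, (∑ m, ((range (legs m).length).filter fun j => legCube m j = k).card) ≤ L)
    {ρ : Option (Finset κ) → ℝ} (hρ : ∀ p, 0 ≤ ρ p) {a b : ℝ} {D : ℕ}
    (hD : ∀ k, (univ.filter fun k' => near k k').card ≤ D)
    (ha : ∀ k, (∑ X ∈ univ.filter (fun X : Finset κ => k ∈ X), ρ (some X)) ≤ a)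
    (hb : ∀ k, (∑ X ∈ univ.filter (fun X : Finset κ => k ∈ X), ρ (some X) * X.card) ≤ b) :
    (∀ u ∈ Dir, (∑ p ∈ univ.filter (fun p =>
        (Option.elim p (cLoc ldist ρr Cw) fun X => cX ldist ρr cubeOf cadj Cw X : Matrix α α ℝ) *ᵥ u ≠ 0), ρ p)
        ≤ ρ none + a) ∧
    (∀ u ∈ Dir, (∑ p, ρ p * ((∑ m, ((range (legs m).length).filter fun j =>
        ((Option.elim p (cLoc ldist ρr Cw) fun X => cX ldist ρr cubeOf cadj Cw X : Matrix α α ℝ) *ᵥ u)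
          ⬝ᵥ (legs m).getD j 0 ≠ 0).card : ℕ) : ℝ)) ≤ L * (ρ none * D + b)) := by
  obtain ⟨hnone, hsome⟩ := split245_support ldist ρr cubeOf cadj inBlock hsupp sdist htri cube hblk near hnear
  -- `[DecidableEq κ]` is in scope here while `split_weighted_locality` is stated with the classical `Finset.filter`
  -- instances: `convert` bridges them (Decidable instances are subsingletons)
  refine split_weighted_locality (near := near)
    (Cov := (fun p => Option.elim p (cLoc ldist ρr Cw) fun X => cX ldist ρr cubeOf cadj Cw X :
      Option (Finset κ) → Matrix α α ℝ))
    (X := fun X : Finset κ => X) (cubeOf := cube) hnone hsome hDir hleg (L := L) (fun k => ?_) hρ hD (a := a)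
    (b := b) (fun k => ?_) (fun k => ?_)
  · convert hL k
  · convert ha k
  · convert hb k

end Literature.MathematicalPhysics.QuantumFieldTheory.BalabanImbrieJaffe1984to88.BIJ88WalkSplitSupport245

end
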